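import Literature.Probability.Percolation.ArmSeparationFrameBelow
import Literature.Probability.Percolation.TrapFenceTall
import HarnessLib

/-!
# The fence of a term explored from above, with a TALL exterior vertical crossing

Topic `Literature/Probability/Percolation`; family `crit-perc` / near-critical percolation on `𝕋`.
A brick of the near-critical arm-separation theorem for four arms in the ADJACENT colour
arrangement (P. Nolin, EJP 13 (2008), Thm. 11, `j = 4`, `σ = BBWW` [arXiv 0711.4948: Thm. 10]).

`trap_exists_fence_below_tall` — the mirror of `trap_exists_fence_tall` for a term explored from
above (`trap_exists_fence_below_gen` with the open vertical crossing through `m` crossing the tall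
box `[z₀ + k, z₀ + 2k] × [z₁ - 2k, z₁ - 1]`, i.e. the right crossing `E` restricted to the rows
below the tip row; the bottom crossing meets its lower part at `m`). Everything here is proved.

## References

* P. Nolin, Near-critical percolation in two dimensions, *Electron. J. Probab.* 13 (2008), §4.4,
  proof of Lemma 15 (arXiv 0711.4948: Lemma 14) [Nolin2008].
* H. Kesten, *Percolation theory for mathematicians* (1982), §2.2 [KestenPTM1982].
-/

noncomputable section

open Set

namespace Literature.Probability.Percolation

open LatticeModels

variable {M k : ℕ} {d : Finset (Site 2)} {z : Site 2}

/-- **The fence from above with a tall vertical crossing** (see the module docstring). [cite: Nolin2008, §4.4 Lemma 15 (proof) (arXiv 0711.4948: Lemma 14)] [cite: KestenPTM1982, §2.2] -/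
theorem trap_exists_fence_below_tall (hk : 1 ≤ k) (hkM : 2 * (k : ℤ) + 1 ≤ M) (hd : (trapDomain M).flip.IsCrossing d z)
    (hz0 : z 1 < 0) (hzB : -(2 * (M : ℤ)) < z 1)
    {ω ω' : SiteConfig (Site 2)}
    (hagree : ∀ v, v ∉ (trapDomain M).flip.lower d z → (v ∈ ω' ↔ v ∈ ω)) (hframe : ω' ∈ triFrameAt z k)
    {S : Set (Site 2)} (hdS : (↑d : Set (Site 2)) ⊆ S) (hSn : ∀ v ∈ S, triNorm v ≤ 2 * M) :
    ∃ m : Site 2, OpenVCrossThrough (triStrip (z 0 + k) (z 1 - 2 * k) k (2 * k - 1)) (z 1 - 2 * k) (z 1 - 1) ω m ∧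
      ∃ q ∈ S, ∃ p : Site 2, triGraph.Adj q p ∧
        PathIn triGraph ((trapFrameZoneBelow M z k ∩
          {v | (triNorm v ≤ 2 * M → v ∈ (trapDomain M).flip.above d z) ∧ (2 * (M : ℤ) < triNorm v → v 1 < z 1)}) ∩
            ω ∩ Sᶜ) p m := by
  have hk' : (1 : ℤ) ≤ k := by exact_mod_cast hk
  have hd' : (trapDomain M).IsCrossing d z := (JDomain.flip_isCrossing_iff _).1 hd
  have hzO := tip_mem_trapO hd'
  have hz' := trapO_coord hzO
  obtain ⟨F⟩ := nonempty_frameData hframe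
  -- sites off `flip.lower d z` (in particular sites outside `Λ_{2M}`) carry the same colour in `ω`, `ω'`
  have hlowD : ∀ v ∈ (trapDomain M).flip.lower d z, v ∈ trapD M := fun v hv => JDomain.lower_subset_D hd.subset hv
  have hext : ∀ v : Site 2, 2 * (M : ℤ) < triNorm v → (v ∈ ω' ↔ v ∈ ω) := by
    intro v hv
    refine hagree v fun h => ?_
    have := (mem_trapD_iff_triNorm.1 (hlowD v h)).2
    omega
  -- the corner box is outside `Λ_{2M}`
  have hEext : ∀ v : Site 2, z 0 + k ≤ v 0 → 2 * (M : ℤ) < triNorm v := by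
    intro v hv
    rw [triNorm_eq_max]
    simp only [lt_max_iff]
    omega
  -- the TALL lower part of the right crossing: a vertical crossing `V` of `[z₀+k, z₀+2k] × [z₁-2k, z₁-1]`
  obtain ⟨e₁, e₂, he₁, he₂, hV⟩ := F.pathE.exists_slab_crossing 1 (L := z 1 - 2 * k) (R := z 1 - 1)
    (by omega) (by rw [F.xE1]) (by rw [F.yE1]; omega)
  obtain ⟨SV, hSV, pV, tV⟩ := hV.exists_support
  have hSVb : ∀ v ∈ SV, z 0 + k ≤ v 0 ∧ v 0 ≤ z 0 + 2 * k ∧ z 1 - 2 * k ≤ v 1 ∧ v 1 ≤ z 1 - 1 := by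
    intro v hv
    have h1 := F.boundsE (hSV hv).1
    have h2 := (hSV hv).2
    simp only [Set.mem_setOf_eq] at h2
    omega
  have hk21 : ((2 * k - 1 : ℕ) : ℤ) = 2 * (k : ℤ) - 1 := by omega
  have hSVω : SV ⊆ triStrip (z 0 + k) (z 1 - 2 * k) k (2 * k - 1) ∩ ω := by
    intro v hv
    have hb := hSVb v hv
    refine ⟨?_, (hext v (hEext v hb.1)).1 ((F.SE_sub (hSV hv).1).2)⟩
    rw [mem_triStrip, hk21]; omega
  -- its lower part: a vertical crossing `V'` of the lower corner box, met by the bottom crossing at `m`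
  obtain ⟨e₁', e₂', he₁', he₂', hV'⟩ := pV.exists_slab_crossing 1 (L := z 1 - 2 * k) (R := z 1 - k)
    (by omega) (by rw [he₁]) (by rw [he₂]; omega)
  obtain ⟨m, hmS, hmV'⟩ := PathIn.tri_crossings_meet (L := z 0 - 2 * k) (R := z 0 + 2 * k)
    (B := z 1 - 2 * k) (T := z 1 - k) (fun v hv => by have := F.boundsS hv; omega)
    (fun v hv => by have := hSVb v hv.1; have h2 := hv.2; simp only [Set.mem_setOf_eq] at h2; omega) F.pathS F.xS0 F.yS0 hV' he₁' he₂'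
  have hmV : m ∈ SV := hmV'.1
  refine ⟨m, ⟨e₁, e₂, he₁, he₂, (tV m hmV).mono hSVω, ((tV m hmV).symm.trans pV).mono hSVω⟩, ?_⟩
  -- `d` (hence `S`) meets `Y`
  have hmY : m ∈ F.Y := Or.inl (Or.inr hmS)
  obtain ⟨f, hfd, hfI⟩ := hd'.exists_start
  obtain ⟨y, hyd, hyK⟩ := F.exists_mem_K hk (s := z) (t := f) (by omega)
    (Or.inl (start_apply_zero_le hd' hkM hfI)) (hd'.conn z hd'.tip_mem f hfd)
  have hyd' : y ∈ d := Finset.mem_coe.1 hyd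
  have hyY : y ∈ F.Y := by
    rcases hyK with hy | hy
    · exact hy
    · exfalso
      have h1 := (F.boundsE hy).1
      have h2 := (mem_trapD.1 (hd'.subset hyd')).2.1
      omega
  -- follow `Y` from `m` to the first site adjacent to `S`
  have hmext : 2 * (M : ℤ) < triNorm m := hEext m (hSVb m hmV).1
  have hmS' : m ∈ Sᶜ := fun h => by have := hSn m h; omega
  obtain ⟨p, q, hpS, hqS, hqY, hpq, hmp⟩ := (F.pathIn_Y hk hmY hyY).exit (R := Sᶜ) hmS' (fun h => h (hdS hyd))
  have hqS' : q ∈ S := not_not.1 hqS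
  have hmp' : PathIn triGraph ((F.Y \ ↑d) ∩ Sᶜ) m p :=
    hmp.mono fun v hv => ⟨⟨hv.2, fun hvd => hv.1 (hdS hvd)⟩, hv.1⟩
  -- the invariant along this path
  set G : Set (Site 2) := {v | (triNorm v ≤ 2 * M → v ∈ (trapDomain M).flip.above d z) ∧
      (2 * (M : ℤ) < triNorm v → v 1 < z 1)} with hG
  have hmG : m ∈ G := ⟨fun h => absurd hmext (not_lt.2 h), fun _ => by have := (hSVb m hmV).2.2.2; omega⟩
  have hpath : PathIn triGraph (((F.Y \ ↑d) ∩ Sᶜ) ∩ G) m p :=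
    hmp'.inter_of_invariant hmG fun x w hx hxG hw hxw =>
      trap_invariant_step_below hk hkM hd hz0 hzB F hx.1 hw.1 hxw hxG.1 hxG.2
  -- sites satisfying the invariant are open sites of the zone
  have hsub : ((F.Y \ ↑d) ∩ Sᶜ) ∩ G ⊆ (trapFrameZoneBelow M z k ∩ G) ∩ ω ∩ Sᶜ := by
    rintro v ⟨⟨⟨hvY, -⟩, hvS⟩, hvin, hvout⟩
    have hb := F.boundsK (F.Y_subset_K hvY)
    have hvω' : v ∈ ω' := F.K_subset (F.Y_subset_K hvY)
    refine ⟨⟨⟨?_, hvin, hvout⟩, ?_⟩, hvS⟩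
    · by_cases hvn : triNorm v ≤ 2 * M
      · have hvT : v ∈ trapD M := mem_trapD_of_triNorm_le (by omega) hvn
        exact ⟨Or.inl hvT, by omega, by omega, by omega, by omega⟩
      · rw [not_le] at hvn
        exact ⟨Or.inr ⟨hvn, hvout hvn⟩, by omega, by omega, by omega, by omega⟩
    · by_cases hvn : triNorm v ≤ 2 * M
      · have hvT : v ∈ trapD M := mem_trapD_of_triNorm_le (by omega) hvn
        -- `v` is `flip.above`, hence off `flip.lower d z`, hence unfrozen
        have hva := hvin hvn
        have hvl : v ∉ (trapDomain M).flip.lower d z := fun h =>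
          ((JDomain.mem_lower_iff_not_mem_above (show v ∈ (trapDomain M).flip.D from hvT)).1 h) hva
        exact (hagree v hvl).1 hvω'
      · rw [not_le] at hvn
        exact (hext v hvn).1 hvω'
  exact ⟨q, hqS', p, hpq.symm, (hpath.mono hsub).symm⟩


/-- **The fence from above with both vertical crossings through `m`** (corner box `[z₀+k, z₀+2k] × [z₁-2k, z₁-k]` and tall box). [cite: Nolin2008, §4.4 Lemma 15 (proof) (arXiv 0711.4948: Lemma 14)] [cite: KestenPTM1982, §2.2] -/
theorem trap_exists_fence_below_tall₂ (hk : 1 ≤ k) (hkM : 2 * (k : ℤ) + 1 ≤ M) (hd : (trapDomain M).flip.IsCrossing d z)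
    (hz0 : z 1 < 0) (hzB : -(2 * (M : ℤ)) < z 1)
    {ω ω' : SiteConfig (Site 2)}
    (hagree : ∀ v, v ∉ (trapDomain M).flip.lower d z → (v ∈ ω' ↔ v ∈ ω)) (hframe : ω' ∈ triFrameAt z k)
    {S : Set (Site 2)} (hdS : (↑d : Set (Site 2)) ⊆ S) (hSn : ∀ v ∈ S, triNorm v ≤ 2 * M) :
    ∃ m : Site 2, OpenVCrossThrough (triStrip (z 0 + k) (z 1 - 2 * k) k k) (z 1 - 2 * k) (z 1 - k) ω m ∧
      OpenVCrossThrough (triStrip (z 0 + k) (z 1 - 2 * k) k (2 * k - 1)) (z 1 - 2 * k) (z 1 - 1) ω m ∧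
      ∃ q ∈ S, ∃ p : Site 2, triGraph.Adj q p ∧
        PathIn triGraph ((trapFrameZoneBelow M z k ∩
          {v | (triNorm v ≤ 2 * M → v ∈ (trapDomain M).flip.above d z) ∧ (2 * (M : ℤ) < triNorm v → v 1 < z 1)}) ∩
            ω ∩ Sᶜ) p m := by
  have hk' : (1 : ℤ) ≤ k := by exact_mod_cast hk
  have hd' : (trapDomain M).IsCrossing d z := (JDomain.flip_isCrossing_iff _).1 hd
  have hzO := tip_mem_trapO hd'
  have hz' := trapO_coord hzO
  obtain ⟨F⟩ := nonempty_frameData hframe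
  -- sites off `flip.lower d z` (in particular sites outside `Λ_{2M}`) carry the same colour in `ω`, `ω'`
  have hlowD : ∀ v ∈ (trapDomain M).flip.lower d z, v ∈ trapD M := fun v hv => JDomain.lower_subset_D hd.subset hv
  have hext : ∀ v : Site 2, 2 * (M : ℤ) < triNorm v → (v ∈ ω' ↔ v ∈ ω) := by
    intro v hv
    refine hagree v fun h => ?_
    have := (mem_trapD_iff_triNorm.1 (hlowD v h)).2
    omega
  -- the corner box is outside `Λ_{2M}`
  have hEext : ∀ v : Site 2, z 0 + k ≤ v 0 → 2 * (M : ℤ) < triNorm v := by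
    intro v hv
    rw [triNorm_eq_max]
    simp only [lt_max_iff]
    omega
  -- the TALL lower part of the right crossing: a vertical crossing `V` of `[z₀+k, z₀+2k] × [z₁-2k, z₁-1]`
  obtain ⟨e₁, e₂, he₁, he₂, hV⟩ := F.pathE.exists_slab_crossing 1 (L := z 1 - 2 * k) (R := z 1 - 1)
    (by omega) (by rw [F.xE1]) (by rw [F.yE1]; omega)
  obtain ⟨SV, hSV, pV, tV⟩ := hV.exists_support
  have hSVb : ∀ v ∈ SV, z 0 + k ≤ v 0 ∧ v 0 ≤ z 0 + 2 * k ∧ z 1 - 2 * k ≤ v 1 ∧ v 1 ≤ z 1 - 1 := by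
    intro v hv
    have h1 := F.boundsE (hSV hv).1
    have h2 := (hSV hv).2
    simp only [Set.mem_setOf_eq] at h2
    omega
  have hk21 : ((2 * k - 1 : ℕ) : ℤ) = 2 * (k : ℤ) - 1 := by omega
  have hSVω : SV ⊆ triStrip (z 0 + k) (z 1 - 2 * k) k (2 * k - 1) ∩ ω := by
    intro v hv
    have hb := hSVb v hv
    refine ⟨?_, (hext v (hEext v hb.1)).1 ((F.SE_sub (hSV hv).1).2)⟩
    rw [mem_triStrip, hk21]; omega
  -- its lower part: a vertical crossing `V'` of the lower corner box, met by the bottom crossing at `m`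
  obtain ⟨e₁', e₂', he₁', he₂', hV'⟩ := pV.exists_slab_crossing 1 (L := z 1 - 2 * k) (R := z 1 - k)
    (by omega) (by rw [he₁]) (by rw [he₂]; omega)
  obtain ⟨SV', hSV', pV', tV'⟩ := hV'.exists_support
  have hSV'b : ∀ v ∈ SV', z 0 + k ≤ v 0 ∧ v 0 ≤ z 0 + 2 * k ∧ z 1 - 2 * k ≤ v 1 ∧ v 1 ≤ z 1 - k := by
    intro v hv
    have hb := hSVb v (hSV' hv).1
    have h2 := (hSV' hv).2
    simp only [Set.mem_setOf_eq] at h2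
    omega
  obtain ⟨m, hmS, hmV''⟩ := PathIn.tri_crossings_meet (L := z 0 - 2 * k) (R := z 0 + 2 * k)
    (B := z 1 - 2 * k) (T := z 1 - k) (fun v hv => by have := F.boundsS hv; omega)
    (fun v hv => by have := hSV'b v hv; omega) F.pathS F.xS0 F.yS0 pV' he₁' he₂'
  have hmV : m ∈ SV := (hSV' hmV'').1
  have hSV'ω : SV' ⊆ triStrip (z 0 + k) (z 1 - 2 * k) k k ∩ ω := by
    intro v hv
    have hb := hSV'b v hv
    refine ⟨?_, (hSVω (hSV' hv).1).2⟩
    rw [mem_triStrip]; omega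
  refine ⟨m, ⟨e₁', e₂', he₁', he₂', (tV' m hmV'').mono hSV'ω, ((tV' m hmV'').symm.trans pV').mono hSV'ω⟩,
    ⟨e₁, e₂, he₁, he₂, (tV m hmV).mono hSVω, ((tV m hmV).symm.trans pV).mono hSVω⟩, ?_⟩
  -- `d` (hence `S`) meets `Y`
  have hmY : m ∈ F.Y := Or.inl (Or.inr hmS)
  obtain ⟨f, hfd, hfI⟩ := hd'.exists_start
  obtain ⟨y, hyd, hyK⟩ := F.exists_mem_K hk (s := z) (t := f) (by omega)
    (Or.inl (start_apply_zero_le hd' hkM hfI)) (hd'.conn z hd'.tip_mem f hfd)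
  have hyd' : y ∈ d := Finset.mem_coe.1 hyd
  have hyY : y ∈ F.Y := by
    rcases hyK with hy | hy
    · exact hy
    · exfalso
      have h1 := (F.boundsE hy).1
      have h2 := (mem_trapD.1 (hd'.subset hyd')).2.1
      omega
  -- follow `Y` from `m` to the first site adjacent to `S`
  have hmext : 2 * (M : ℤ) < triNorm m := hEext m (hSVb m hmV).1
  have hmS' : m ∈ Sᶜ := fun h => by have := hSn m h; omega
  obtain ⟨p, q, hpS, hqS, hqY, hpq, hmp⟩ := (F.pathIn_Y hk hmY hyY).exit (R := Sᶜ) hmS' (fun h => h (hdS hyd))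
  have hqS' : q ∈ S := not_not.1 hqS
  have hmp' : PathIn triGraph ((F.Y \ ↑d) ∩ Sᶜ) m p :=
    hmp.mono fun v hv => ⟨⟨hv.2, fun hvd => hv.1 (hdS hvd)⟩, hv.1⟩
  -- the invariant along this path
  set G : Set (Site 2) := {v | (triNorm v ≤ 2 * M → v ∈ (trapDomain M).flip.above d z) ∧
      (2 * (M : ℤ) < triNorm v → v 1 < z 1)} with hG
  have hmG : m ∈ G := ⟨fun h => absurd hmext (not_lt.2 h), fun _ => by have := (hSVb m hmV).2.2.2; omega⟩
  have hpath : PathIn triGraph (((F.Y \ ↑d) ∩ Sᶜ) ∩ G) m p :=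
    hmp'.inter_of_invariant hmG fun x w hx hxG hw hxw =>
      trap_invariant_step_below hk hkM hd hz0 hzB F hx.1 hw.1 hxw hxG.1 hxG.2
  -- sites satisfying the invariant are open sites of the zone
  have hsub : ((F.Y \ ↑d) ∩ Sᶜ) ∩ G ⊆ (trapFrameZoneBelow M z k ∩ G) ∩ ω ∩ Sᶜ := by
    rintro v ⟨⟨⟨hvY, -⟩, hvS⟩, hvin, hvout⟩
    have hb := F.boundsK (F.Y_subset_K hvY)
    have hvω' : v ∈ ω' := F.K_subset (F.Y_subset_K hvY)
    refine ⟨⟨⟨?_, hvin, hvout⟩, ?_⟩, hvS⟩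
    · by_cases hvn : triNorm v ≤ 2 * M
      · have hvT : v ∈ trapD M := mem_trapD_of_triNorm_le (by omega) hvn
        exact ⟨Or.inl hvT, by omega, by omega, by omega, by omega⟩
      · rw [not_le] at hvn
        exact ⟨Or.inr ⟨hvn, hvout hvn⟩, by omega, by omega, by omega, by omega⟩
    · by_cases hvn : triNorm v ≤ 2 * M
      · have hvT : v ∈ trapD M := mem_trapD_of_triNorm_le (by omega) hvn
        -- `v` is `flip.above`, hence off `flip.lower d z`, hence unfrozen
        have hva := hvin hvn
        have hvl : v ∉ (trapDomain M).flip.lower d z := fun h =>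
          ((JDomain.mem_lower_iff_not_mem_above (show v ∈ (trapDomain M).flip.D from hvT)).1 h) hva
        exact (hagree v hvl).1 hvω'
      · rw [not_le] at hvn
        exact (hext v hvn).1 hvω'
  exact ⟨q, hqS', p, hpq.symm, (hpath.mono hsub).symm⟩


end Literature.Probability.Percolation
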